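import Literature.NumberTheory.EllipticCurves.LocalWeilPairingDuality
import Literature.NumberTheory.EllipticCurves.LocalKummerSequenceSurjective
import Literature.NumberTheory.EllipticCurves.LocalTorsionInvariants
import Literature.NumberTheory.GaloisRepresentations.ContinuousH1OrderTwo
import Mathlib.NumberTheory.NumberField.Completion.InfinitePlace
import HarnessLib

/-!
# The archimedean local input of the Cassels–Tate pairing: `#H¹(K_w, E[n]) ≤ (#𝓛_w)²` at an infinite place

Topic `NumberTheory/EllipticCurves`; namespaces `WeierstrassCurve` (curve-specific statements),
`Literature.NumberTheory.GaloisRepresentations` (a counting lemma on `H¹` of a group of order `≤ 2`) and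
`Literature.NumberTheory.EllipticCurves` (the Weil-pairing consequences, as the sibling
`LocalWeilPairingDuality.lean`). Definitions with bodies and theorems only: **no named fact is introduced**
(D-0026).

Let `K` be a number field, `E = W` an elliptic curve over `K`, `w` an infinite place of `K` with completion
`K_w ≅ ℝ` or `ℂ`, `n ≠ 0`, and `𝓛_w = kummerLocalConditionAt W n K_w ≤ H¹(K_w, E[n])` the local Kummer
condition (the image of `E(K_w)/n`, Silverman *AEC* X.§4; `LocalKummerMap.lean`).  In the proof of the
Cassels–Tate theorem (Milne, *ADT*, I Thm. 6.13(a) through Lemma 6.15, with `S ⊇` the archimedean places)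
the local input at EVERY place of `S` is that `𝓛_v` is its own annihilator under the local cup product;
at an archimedean place this is Tate local duality over `ℝ` (Milne I Thm. 2.13 and Rem. 3.7: for `K = ℝ`,
`H¹(ℝ, A)` is dual to `π₀(A(ℝ)) = A(ℝ)/A(ℝ)°`).  Given perfectness of the local pairing, maximality is the
count `#H¹(K_w, E[n]) ≤ (#𝓛_w)²` (the counting lemma
`forall_mem_apply_eq_zero_iff_of_isotropic_of_card_le` of `LocalWeilPairingDuality.lean` and the isotropy
of `𝓛_w`, the discharged Poonen–Rains fact).  This file PROVES that count at every infinite place and all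
`n ≠ 0` — without any Lie theory of `E(ℝ)`:

* `n` odd, or `w` complex: `H¹(K_w, E[n]) = 0` (`Γ_{K_w}` has order `≤ 2`, tree
  `ContinuousH1OrderTwo.lean`; `Γ_ℂ = 1`).
* `n` even, `w` real.  Since `H¹(K_w, E)` is killed by `2`, the local Kummer sequences at levels `n` and
  `2` (`#H¹(K_w, E)[m] · #𝓛^{(m)} = #H¹(K_w, E[m])`, `LocalKummerSequenceSurjective.lean`) give
  `#H¹(K_w, E[n]) · #𝓛^{(2)} = #H¹(K_w, E[2]) · #𝓛^{(n)}`; for a group `Γ = {1, c}` acting on a finite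
  module `M` with `2M = 0` the crossed-homomorphism description of `H¹` (`ContinuousH1.lean`) gives
  `#H¹(Γ, M) · #M ≤ (#M^Γ)²` (`natCard_continuousCohomology_one_mul_card_le_sq_of_natCard_le_two`), so
  `4 · #H¹(K_w, E[2]) ≤ (#E(K_w)[2])²` (`#E[2] = 4`, `H⁰(K_w, E[2]) = E(K_w)[2]`,
  `LocalTorsionInvariants.lean`); and `#𝓛^{(m)} = [E(K_w) : m E(K_w)]` (`LocalKummerMap.lean`).  The count
  thus reduces to `#E(K_w)[2] ≤ 2 · [E(K_w) : 2E(K_w)]`, i.e. to the REAL-ALGEBRA fact: *if all three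
  points of order `2` are `K_w`-rational then `E(K_w) ≠ 2E(K_w)`* — the point `T = (e₂, ·)` of order two
  with the SMALLER abscissa is not divisible by `2`, because for every affine `Q = (x, y) ∉ E[2]` and every
  `2`-torsion abscissa `e` the duplication formula (Silverman *AEC* III.2.3(d)) gives
  `4 · (x(2Q) - e) · (2y + a₁x + a₃)² = (2(x - e)² - g'(e)/2)²  ≥ 0`,
  `g(X) = 4X³ + b₂X² + 2b₄X + b₆` (`four_mul_addX_self_sub_mul_sq`, `le_addX_self`), whence
  `x(2Q) ≥ e₁ > e₂` (`range_zsmulAddGroupHom_two_ne_top`, over any linearly ordered field, transported to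
  `K_w ≃+* ℝ` along `pointEquivOfRingEquiv`).

Main statements:

* `WeierstrassCurve.natCard_galoisCohomology_one_torsion_le_sq_infinitePlace`:
  `#H¹(K_w, E[n]) ≤ #𝓛_w · #𝓛_w` for every infinite place `w` and `n ≠ 0` — the `hcard` input of
  `forall_mem_kummerLocalConditionAt_weilCupProduct_eq_zero_iff` at the archimedean places;
* `Literature.NumberTheory.EllipticCurves.forall_mem_kummerLocalConditionAt_weilCupProduct_eq_zero_iff_of_leftKernel`
  (any `K`-field `F` with `H¹(F, E[n])` finite, given the count and the triviality of the left kernel of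
  `ι ∘ ∪ₑ` for some additive `ι : H²(Γ_F, μₙ) → ℤ/n` — local Tate duality at `F`):
  `(∀ y ∈ 𝓛_F, x ∪ₑ y = 0) ↔ x ∈ 𝓛_F`; and its archimedean specialisations
  `…_infinitePlace`, `…_inl` (the local condition `kummerSelmerStructure n (Sum.inl w)` and the local Weil
  pairing `weilContPairingLocal … (Sum.inl w)`), where only the archimedean local duality (Milne I
  Thm. 2.13(a)) remains a hypothesis.

Motivation: provefact `WeierstrassCurve.exists_casselsTate_pairing` (Silverman *AEC* X.4.14; Milne *ADT*
I.6.13(a)), kernel direction, archimedean places at even level.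

## References

* [MilneADT2006] J. S. Milne, *Arithmetic Duality Theorems*, 2nd ed. (2006), Ch. I: Thm. 2.13, Rem. 3.7,
  Cor. 3.4, §6 (Lemma 6.15, proof of Thm. 6.13(a)).
* [SilvermanAEC2009] J. H. Silverman, *The Arithmetic of Elliptic Curves*, 2nd ed. (2009), III.2.3(d)
  (duplication formula), X.§4 (diagram (**)), X.4.14.
* [SerreGaloisCohomology1997] J.-P. Serre, *Galois Cohomology* (1997), I §2.4, I §5.1.
-/

noncomputable section

open scoped Classical

universe u

/-! ## The duplication formula against a `2`-torsion abscissa; a rational `2`-torsion point not divisible by `2` -/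

namespace WeierstrassCurve

section Duplication

variable {R : Type*} [CommRing R] (V : Affine R)

/-- **The duplication formula measured from a `2`-torsion abscissa.**  Let `(x, y)` and `(e, y')` satisfy
the Weierstrass equation, `(e, y')` being of order `2` (`y' = -y' - a₁e - a₃`), and let `ℓ` be the slope of
the tangent at `(x, y)` (`ℓ · (2y + a₁x + a₃) = 3x² + 2a₂x + a₄ - a₁y`).  Then the abscissa
`x(2(x, y)) = addX x x ℓ = ℓ² + a₁ℓ - a₂ - 2x` satisfies
`4 · (x(2(x,y)) - e) · (2y + a₁x + a₃)² = (2(x - e)² - (a₁²e + a₁a₃ + 4a₂e + 2a₄ + 6e²))²`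
(the bracket is `g'(e)/2`, `g(X) = 4X³ + b₂X² + 2b₄X + b₆ = (2Y + a₁X + a₃)²`): the classical
`x(2Q) - e = ((x - e)² - g'(e)/4)² / (4 f(x))` of `2`-descent.  Silverman, *AEC*, III.2.3(d) (duplication
formula `x(2P) = (x⁴ - b₄x² - 2b₆x - b₈)/(4x³ + b₂x² + 2b₄x + b₆)`). [cite: SilvermanAEC2009, III.2.3(d)] -/
theorem four_mul_addX_self_sub_mul_sq {x y e y' ℓ : R}
    (h₁ : y ^ 2 + V.a₁ * x * y + V.a₃ * y = x ^ 3 + V.a₂ * x ^ 2 + V.a₄ * x + V.a₆)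
    (h₂ : y' ^ 2 + V.a₁ * e * y' + V.a₃ * y' = e ^ 3 + V.a₂ * e ^ 2 + V.a₄ * e + V.a₆)
    (hT : y' = -y' - V.a₁ * e - V.a₃)
    (hℓ : ℓ * (y - (-y - V.a₁ * x - V.a₃)) = 3 * x ^ 2 + 2 * V.a₂ * x + V.a₄ - V.a₁ * y) :
    4 * (V.addX x x ℓ - e) * (y - (-y - V.a₁ * x - V.a₃)) ^ 2 =
      (2 * (x - e) ^ 2 - (V.a₁ ^ 2 * e + V.a₁ * V.a₃ + 4 * V.a₂ * e + 2 * V.a₄ + 6 * e ^ 2)) ^ 2 := by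
  simp only [Affine.addX]
  linear_combination
    (4 * (ℓ * (y - (-y - V.a₁ * x - V.a₃)) + (3 * x ^ 2 + 2 * V.a₂ * x + V.a₄ - V.a₁ * y) +
        V.a₁ * (y - (-y - V.a₁ * x - V.a₃)))) * hℓ +
      (4 * (-V.a₁ ^ 2 - 4 * V.a₂ - 8 * x - 4 * e)) * h₁ +
      ((-V.a₁ ^ 2 - 4 * V.a₂ - 8 * x - 4 * e) * (y' - (-y' - V.a₁ * e - V.a₃))) * hT +
      (4 * V.a₁ ^ 2 + 16 * V.a₂ + 32 * x + 16 * e) * h₂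

end Duplication

section Ordered

variable {L : Type*} [Field L] [LinearOrder L] [IsStrictOrderedRing L] [DecidableEq L] (V : Affine L)

/-- Over a linearly ordered field, **doubling never lands below a `2`-torsion abscissa**: if `(e, y')`
is a point of order `2` on `V` and `(x, y)` a point with `y ≠ -y - a₁x - a₃` (not of order `2`), then
`e ≤ x(2 (x, y))`.  (From `four_mul_addX_self_sub_mul_sq`: a square divided by a non-zero square.)
[cite: SilvermanAEC2009, III.2.3(d)] -/
theorem le_addX_self {x y e y' : L} (h₁ : V.Equation x y) (h₂ : V.Equation e y')
    (hT : y' = V.negY e y') (hy : y ≠ V.negY x y) :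
    e ≤ V.addX x x (V.slope x x y y) := by
  rw [Affine.equation_iff] at h₁ h₂
  have hD : y - (-y - V.a₁ * x - V.a₃) ≠ 0 := sub_ne_zero.mpr hy
  have hℓ : V.slope x x y y * (y - (-y - V.a₁ * x - V.a₃)) =
      3 * x ^ 2 + 2 * V.a₂ * x + V.a₄ - V.a₁ * y := by
    rw [Affine.slope_of_Y_ne rfl hy]
    exact div_mul_cancel₀ _ hD
  have key := V.four_mul_addX_self_sub_mul_sq h₁ h₂ hT hℓ
  have hsq : 0 ≤ 4 * (V.addX x x (V.slope x x y y) - e) * (y - (-y - V.a₁ * x - V.a₃)) ^ 2 := by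
    rw [key]; exact sq_nonneg _
  have hD2 : 0 < (y - (-y - V.a₁ * x - V.a₃)) ^ 2 := by positivity
  have h4 : 0 ≤ 4 * (V.addX x x (V.slope x x y y) - e) := (mul_nonneg_iff_of_pos_right hD2).mp hsq
  have h' : 0 ≤ V.addX x x (V.slope x x y y) - e :=
    (mul_nonneg_iff_of_pos_left (by norm_num : (0 : L) < 4)).mp h4
  exact sub_nonneg.mp h'

/-- A point of order `2` with abscissa `e₂` is **not twice a rational point** as soon as there is a
`2`-torsion abscissa `e₁ > e₂`: `x(2Q) ≥ e₁ > e₂` for `Q ∉ V[2]` (`le_addX_self`), and `2Q = 0` otherwise.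
[cite: SilvermanAEC2009, III.2.3(d)] -/
theorem add_self_ne_of_lt {e₁ y₁ e₂ y₂ : L} (h₁ : V.Equation e₁ y₁) (hT₁ : y₁ = V.negY e₁ y₁)
    (h₂ : V.Nonsingular e₂ y₂) (hlt : e₂ < e₁) (Q : V.Point) :
    Q + Q ≠ Affine.Point.some e₂ y₂ h₂ := by
  rcases Q with _ | ⟨x, y, hQ⟩
  · change (0 : V.Point) + 0 ≠ _
    rw [add_zero]
    exact fun h => by cases h
  · by_cases hy : y = V.negY x y
    · rw [Affine.Point.add_self_of_Y_eq hy]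
      exact fun h => by cases h
    · rw [Affine.Point.add_self_of_Y_ne hy]
      intro h
      simp only [Affine.Point.some.injEq] at h
      have hle := V.le_addX_self hQ.1 h₁ hT₁ hy
      rw [h.1] at hle
      exact absurd hlt (not_lt.mpr hle)

omit [LinearOrder L] [IsStrictOrderedRing L] in
/-- A non-zero point killed by `2` is an affine point `(e, y)` with `y = -y - a₁e - a₃`. [folklore] -/
theorem exists_eq_some_of_two_torsion {P : V.Point} (hP : P ≠ 0) (h2 : P + P = 0) :
    ∃ (e y : L) (h : V.Nonsingular e y), P = Affine.Point.some e y h ∧ y = V.negY e y := by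
  rcases P with _ | ⟨e, y, h⟩
  · exact absurd Affine.Point.zero_def hP
  · refine ⟨e, y, h, rfl, ?_⟩
    by_contra hy
    rw [Affine.Point.add_self_of_Y_ne hy] at h2
    cases h2

/-- **Full rational `2`-torsion obstructs `2`-divisibility over an ordered field.**  If `V(L)` contains
two distinct non-zero points killed by `2`, then `2 · V(L) ≠ V(L)`: of the two, the point with the smaller
abscissa is not divisible by `2` (`add_self_ne_of_lt`).  Over `L = ℝ` this is "`[E(ℝ) : 2E(ℝ)] = 2` when
`Δ > 0`" (Milne, *ADT*, I Rem. 3.7: `H¹(ℝ, A) ≅ π₀(A(ℝ))^*`; Silverman, *AEC*, X.§4), in the weak form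
needed for counting. [cite: MilneADT2006, I Rem. 3.7] [cite: SilvermanAEC2009, III.2.3(d)] -/
theorem range_zsmulAddGroupHom_two_ne_top {P₁ P₂ : V.Point} (hP₁ : P₁ ≠ 0) (hP₂ : P₂ ≠ 0)
    (h₁ : P₁ + P₁ = 0) (h₂ : P₂ + P₂ = 0) (hne : P₁ ≠ P₂) :
    (zsmulAddGroupHom 2 : V.Point →+ V.Point).range ≠ ⊤ := by
  obtain ⟨e₁, y₁, hn₁, rfl, hy₁⟩ := V.exists_eq_some_of_two_torsion hP₁ h₁
  obtain ⟨e₂, y₂, hn₂, rfl, hy₂⟩ := V.exists_eq_some_of_two_torsion hP₂ h₂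
  -- the abscissae differ
  have he : e₁ ≠ e₂ := by
    rintro rfl
    apply hne
    have hy : y₁ = y₂ := by
      have h1 : 2 * y₁ = -V.a₁ * e₁ - V.a₃ := by
        rw [Affine.negY] at hy₁; linear_combination hy₁
      have h2 : 2 * y₂ = -V.a₁ * e₁ - V.a₃ := by
        rw [Affine.negY] at hy₂; linear_combination hy₂
      have := h1.trans h2.symm
      exact mul_left_cancel₀ two_ne_zero this
    subst hy
    rfl
  -- the point with the smaller abscissa is not divisible by `2`
  have key : ∀ {e y e' y' : L} (hn : V.Nonsingular e y) (hn' : V.Nonsingular e' y'),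
      y' = V.negY e' y' → e < e' →
        (zsmulAddGroupHom 2 : V.Point →+ V.Point).range ≠ ⊤ := by
    intro e y e' y' hn hn' hy' hlt htop
    have hmem : Affine.Point.some e y hn ∈ (zsmulAddGroupHom 2 : V.Point →+ V.Point).range := by
      rw [htop]; exact AddSubgroup.mem_top _
    obtain ⟨Q, hQ⟩ := hmem
    rw [zsmulAddGroupHom_apply, two_zsmul] at hQ
    exact V.add_self_ne_of_lt hn'.1 hy' hn hlt Q hQ
  rcases lt_or_gt_of_ne he with hlt | hlt
  · exact key hn₁ hn₂ hy₂ hlt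
  · exact key hn₂ hn₁ hy₁ hlt

end Ordered

/-! ## Transport of rational points along a ring isomorphism of the base field -/

section Transport

variable {K : Type u} [Field K] (W : WeierstrassCurve K)
variable {F : Type*} [Field F] [Algebra K F] {L : Type*} [Field L] [DecidableEq F] [DecidableEq L]

/-- **`E(F) ≃+ E(L)` along a ring isomorphism `f : F ≃+* L`** of `K`-fields (`L` given the `K`-algebra
structure through `f`): Mathlib's `Point.map` of `f` and of `f⁻¹`. [folklore] -/
theorem nonempty_addEquiv_point_of_ringEquiv (f : F ≃+* L) :
    letI : Algebra K L := (f.toRingHom.comp (algebraMap K F)).toAlgebra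
    Nonempty ((W.baseChange F).toAffine.Point ≃+ (W.baseChange L).toAffine.Point) := by
  letI : Algebra K L := (f.toRingHom.comp (algebraMap K F)).toAlgebra
  let f' : F →ₐ[K] L := { f.toRingHom with commutes' := fun _ => rfl }
  let g' : L →ₐ[K] F :=
    { f.symm.toRingHom with
      commutes' := fun k => by
        change f.symm (f (algebraMap K F k)) = algebraMap K F k
        exact f.symm_apply_apply _ }
  refine ⟨AddEquiv.ofBijective (Affine.Point.map f') ⟨Affine.Point.map_injective (f := f'), ?_⟩⟩
  intro Q
  refine ⟨Affine.Point.map g' Q, ?_⟩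
  rcases Q with _ | ⟨x, y, h⟩
  · rfl
  · rw [Affine.Point.map_some, Affine.Point.map_some]
    simp only [Affine.Point.some.injEq]
    exact ⟨f.apply_symm_apply x, f.apply_symm_apply y⟩

/-- **`2E(F) ≠ E(F)` when `E(F)` has full rational `2`-torsion and `F ≅ ℝ`** (more generally `F`
ring-isomorphic to a linearly ordered field): transport of `range_zsmulAddGroupHom_two_ne_top` along
`E(F) ≃+ E(L)`. [cite: MilneADT2006, I Rem. 3.7] -/
theorem range_zsmulAddGroupHom_two_ne_top_of_ringEquiv [LinearOrder L] [IsStrictOrderedRing L]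
    (f : F ≃+* L) {P₁ P₂ : (W.baseChange F).toAffine.Point} (hP₁ : P₁ ≠ 0) (hP₂ : P₂ ≠ 0)
    (h₁ : P₁ + P₁ = 0) (h₂ : P₂ + P₂ = 0) (hne : P₁ ≠ P₂) :
    (zsmulAddGroupHom 2 : (W.baseChange F).toAffine.Point →+ _).range ≠ ⊤ := by
  letI : Algebra K L := (f.toRingHom.comp (algebraMap K F)).toAlgebra
  obtain ⟨φ⟩ := W.nonempty_addEquiv_point_of_ringEquiv f
  have hL := range_zsmulAddGroupHom_two_ne_top (W.baseChange L).toAffine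
    (P₁ := φ P₁) (P₂ := φ P₂) (by simpa using hP₁) (by simpa using hP₂)
    (by rw [← map_add, h₁, map_zero]) (by rw [← map_add, h₂, map_zero]) (φ.injective.ne hne)
  intro htop
  apply hL
  rw [eq_top_iff]
  rintro Q -
  obtain ⟨P, rfl⟩ := φ.surjective Q
  have hP : P ∈ (zsmulAddGroupHom 2 : (W.baseChange F).toAffine.Point →+ _).range := by
    rw [htop]; exact AddSubgroup.mem_top _
  obtain ⟨R, hR⟩ := hP
  refine ⟨φ R, ?_⟩
  rw [zsmulAddGroupHom_apply] at hR ⊢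
  rw [← hR, map_zsmul]

end Transport

end WeierstrassCurve

/-! ## `#H¹(Γ, M) · #M ≤ (#M^Γ)²` for a group of order `≤ 2` acting on a module killed by `2` -/

namespace Literature.NumberTheory.GaloisRepresentations

open _root_.TopRep Function

section OrderTwo

universe v

variable {R : Type u} [CommRing R] [TopologicalSpace R]
variable {G : Type v} [Group G] [TopologicalSpace G] [IsTopologicalGroup G]

omit [TopologicalSpace G] [IsTopologicalGroup G] in
/-- `ρ(a) (ρ(b) y) = ρ(ab) y` for a topological representation. [folklore] -/
private theorem ρ_mul_apply (X : TopRep.{v} R G) (a b : G) (x : X) :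
    X.ρ a (X.ρ b x) = X.ρ (a * b) x := by
  rw [← ContinuousLinearMap.comp_apply, ← ContinuousLinearMap.mul_def, ← map_mul]

/-- `H¹(G, X) = 0` for the trivial group. [folklore] -/
theorem continuousCohomology_one_eq_zero_of_forall_eq_one (hG : ∀ g : G, g = 1) (X : TopRep.{v} R G)
    (x : continuousCohomology 1 X) : x = 0 := by
  obtain ⟨φ, rfl⟩ := oneCocycleClass_surjective X x
  rw [oneCocycleClass_eq_zero_iff]
  exact ⟨0, fun g => by rw [hG g, contOneCocycles.apply_one, map_zero, sub_zero]⟩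

/-- **`H¹` of a finite group with finite coefficients is finite** (crossed homomorphisms are maps
`G → X`). [folklore] -/
theorem finite_continuousCohomology_one_of_finite [Finite G] (X : TopRep.{v} R G) [Finite X] :
    Finite (continuousCohomology 1 X) := by
  haveI : Finite (contOneCocycles X) :=
    Finite.of_injective (fun φ : contOneCocycles X => ((φ : C(G, X)) : G → X))
      fun φ ψ h => Subtype.ext (ContinuousMap.ext (congrFun h))
  exact Finite.of_surjective _ (oneCocycleClass_surjective X)

/-- **`#H¹(G, X) · #X ≤ (#X^G)²` for a group `G` of order `≤ 2` and a finite coefficient module `X`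
killed by `2`.**  For `G = {1, c}`: a crossed homomorphism `φ` is determined by `φ(c)`, which lies in
`Ker(1 + c) = Ker(c - 1) = X^G` (as `-1 = 1` on `X`), and `φ` is principal iff `φ(c) ∈ Im(c - 1)`; so
`#H¹ = #Z¹/#B¹ ≤ #X^G / #Im(c - 1) = (#X^G)²/#X`.  (For `G = Gal(ℂ/ℝ)` and `X = E[2]` this is
`4 · #H¹(ℝ, E[2]) ≤ (#E(ℝ)[2])²`.)  Serre, *Galois Cohomology*, I §5.1 (crossed homomorphisms), I §2.4.
[cite: SerreGaloisCohomology1997, I §5.1] -/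
theorem natCard_continuousCohomology_one_mul_card_le_sq_of_natCard_le_two [Finite G]
    [DiscreteTopology G] (hG : Nat.card G ≤ 2) (X : TopRep.{v} R G) [Finite X]
    (h2 : ∀ x : X, 2 • x = 0) :
    Nat.card (continuousCohomology 1 X) * Nat.card X ≤
      Nat.card {x : X // ∀ g : G, X.ρ g x = x} ^ 2 := by
  haveI : Finite (contOneCocycles X) :=
    Finite.of_injective (fun φ : contOneCocycles X => ((φ : C(G, X)) : G → X))
      fun φ ψ h => Subtype.ext (ContinuousMap.ext (congrFun h))
  have hsurj := oneCocycleClass_surjective X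
  haveI : Finite (continuousCohomology 1 X) := Finite.of_surjective _ hsurj
  by_cases htriv : ∀ g : G, g = 1
  · -- trivial group: `H¹ = 0`, `X^G = X`
    haveI : Subsingleton (continuousCohomology 1 X) :=
      ⟨fun a b => (continuousCohomology_one_eq_zero_of_forall_eq_one htriv X a).trans
        (continuousCohomology_one_eq_zero_of_forall_eq_one htriv X b).symm⟩
    have hInv : Nat.card {x : X // ∀ g : G, X.ρ g x = x} = Nat.card X :=
      Nat.card_congr (Equiv.subtypeUnivEquiv fun x g => by
        rw [htriv g, map_one]; rfl)
    rw [Nat.card_of_subsingleton (0 : continuousCohomology 1 X), one_mul, hInv, sq]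
    exact Nat.le_mul_self _
  · push Not at htriv
    obtain ⟨c, hc⟩ := htriv
    have hgc : ∀ g : G, g ≠ 1 → g = c := fun g hg => eq_of_ne_one_of_natCard_le_two hG hg hc
    -- evaluation at `c` is injective on crossed homomorphisms
    have hev : Injective fun φ : contOneCocycles X => φ.1 c := by
      intro φ ψ h
      apply Subtype.ext
      apply ContinuousMap.ext
      intro g
      rcases eq_or_ne g 1 with rfl | hg
      · rw [contOneCocycles.apply_one, contOneCocycles.apply_one]
      · rw [hgc g hg]; exact h
    -- `f = ρ(c) - 1`
    let f : X →+ X := AddMonoidHom.mk' (fun x => X.ρ c x - x) fun a b => by rw [map_add]; abel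
    have hf_apply : ∀ x : X, f x = X.ρ c x - x := fun _ => rfl
    -- `Z¹ ↪ Ker(1 + c) = Ker f`
    have hZ_le : Nat.card (contOneCocycles X) ≤ Nat.card f.ker := by
      refine Nat.card_le_card_of_injective (fun φ => (⟨φ.1 c, ?_⟩ : f.ker))
        (fun φ ψ h => hev (congrArg Subtype.val h))
      rw [AddMonoidHom.mem_ker, hf_apply]
      have h := φ.2 c c
      rw [mul_self_eq_one_of_natCard_le_two hG, contOneCocycles.apply_one] at h
      have hneg : X.ρ c (φ.1 c) = -φ.1 c := eq_neg_of_add_eq_zero_right h.symm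
      have h2c := h2 (φ.1 c)
      rw [two_nsmul] at h2c
      rw [hneg, ← neg_add', h2c, neg_zero]
    -- `#Z¹ = #B¹ · #H¹`
    let cls : contOneCocycles X →ₗ[R] continuousCohomology 1 X := oneCocycleClassₗ X
    have hcls : ∀ φ, cls φ = oneCocycleClass X φ := fun _ => rfl
    have hclsurj : Surjective cls := hsurj
    have hZ : Nat.card (contOneCocycles X) =
        Nat.card (LinearMap.ker cls) * Nat.card (continuousCohomology 1 X) := by
      rw [Submodule.card_eq_card_quotient_mul_card (LinearMap.ker cls)]
      exact congrArg _ (Nat.card_congr (cls.quotKerEquivOfSurjective hclsurj).toEquiv)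
    -- `B¹ ≃ Im f` by evaluation at `c`
    have hB : Nat.card (LinearMap.ker cls) = Nat.card f.range := by
      have hmem : ∀ φ : LinearMap.ker cls, φ.1.1 c ∈ f.range := fun φ => by
        obtain ⟨v, hv⟩ := (oneCocycleClass_eq_zero_iff X φ.1).mp
          ((hcls φ.1).symm.trans (LinearMap.mem_ker.mp φ.2))
        exact ⟨v, (hv c).symm⟩
      refine Nat.card_congr (Equiv.ofBijective (fun φ => (⟨φ.1.1 c, hmem φ⟩ : f.range)) ⟨?_, ?_⟩)
      · intro φ ψ h
        exact Subtype.ext (hev (congrArg Subtype.val h))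
      · rintro ⟨_, v, rfl⟩
        -- the principal crossed homomorphism of `v`
        have hcob : (⟨fun g => X.ρ g v - v, continuous_of_discreteTopology⟩ : C(G, X)) ∈
            contOneCocycles X := by
          intro g h
          change X.ρ (g * h) v - v = (X.ρ g v - v) + X.ρ g (X.ρ h v - v)
          rw [map_sub, ρ_mul_apply]
          abel
        have hker : (⟨_, hcob⟩ : contOneCocycles X) ∈ LinearMap.ker cls := by
          rw [LinearMap.mem_ker, hcls, oneCocycleClass_eq_zero_iff]
          exact ⟨v, fun g => rfl⟩
        exact ⟨⟨_, hker⟩, rfl⟩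
    -- `#Im f · #Ker f = #X`
    have hf : Nat.card f.range * Nat.card f.ker = Nat.card X := by
      rw [← Nat.card_congr (QuotientAddGroup.quotientKerEquivRange f).toEquiv]
      exact (AddSubgroup.card_eq_card_quotient_mul_card_addSubgroup f.ker).symm
    -- `Ker f = X^G`
    have hker : Nat.card f.ker = Nat.card {x : X // ∀ g : G, X.ρ g x = x} := by
      refine Nat.card_congr (Equiv.subtypeEquivRight fun x => ?_)
      rw [AddMonoidHom.mem_ker, hf_apply, sub_eq_zero]
      refine ⟨fun h g => ?_, fun h => h c⟩
      rcases eq_or_ne g 1 with rfl | hg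
      · rw [map_one]; rfl
      · rw [hgc g hg]; exact h
    calc Nat.card (continuousCohomology 1 X) * Nat.card X
        = Nat.card (continuousCohomology 1 X) * (Nat.card f.range * Nat.card f.ker) := by rw [hf]
      _ = Nat.card (contOneCocycles X) * Nat.card f.ker := by rw [hZ, hB]; ring
      _ ≤ Nat.card f.ker * Nat.card f.ker := Nat.mul_le_mul_right _ hZ_le
      _ = Nat.card {x : X // ∀ g : G, X.ρ g x = x} ^ 2 := by rw [hker, sq]

end OrderTwo

section Galois

variable {F : Type u} [Field F] {M : Type u} [AddCommGroup M] [TopologicalSpace M] [DiscreteTopology M]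

/-- **`H¹(F, M)` is finite** for a field with finite absolute Galois group (`F ≅ ℝ` or `ℂ`) and a finite
discrete module `M`. [folklore] -/
theorem finite_galoisCohomology_one_of_finite_absoluteGaloisGroup [Finite (Field.absoluteGaloisGroup F)]
    [Finite M] (ρ : DiscreteGaloisModule F M) : Finite (galoisCohomology ρ 1) :=
  finite_continuousCohomology_one_of_finite ρ.toTopRep

/-- **`H¹(F, M) = 0`** for a field with trivial absolute Galois group (`F` algebraically closed). [folklore] -/
theorem galoisCohomology_one_eq_zero_of_subsingleton [Subsingleton (Field.absoluteGaloisGroup F)]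
    (ρ : DiscreteGaloisModule F M) (x : galoisCohomology ρ 1) : x = 0 :=
  continuousCohomology_one_eq_zero_of_forall_eq_one (fun g => Subsingleton.elim g 1) ρ.toTopRep x

end Galois

end Literature.NumberTheory.GaloisRepresentations

/-! ## The count `#H¹(K_w, E[n]) ≤ (#𝓛_w)²` at an infinite place -/

namespace WeierstrassCurve

open Literature.NumberTheory.EllipticCurves Literature.NumberTheory.GaloisRepresentations Field Function
  NumberField

variable {K : Type u} [Field K] [NumberField K] (W : WeierstrassCurve K) [W.IsElliptic]

omit [NumberField K] in
/-- `H¹(F, E[n])` is finite for a `K`-field `F` with finite absolute Galois group (`n ≠ 0`). [folklore] -/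
theorem finite_galoisCohomology_one_torsion_restrictField_of_finite (F : Type u) [Field F] [Algebra K F]
    [Finite (absoluteGaloisGroup F)] {n : ℤ} (hn : n ≠ 0) :
    Finite (galoisCohomology (GaloisRep.restrictField F (W.torsionGaloisModule n)) 1) :=
  haveI : Finite (geomTorsion W n) := finite_torsionPoints_holds W (AlgebraicClosure K) hn
  finite_galoisCohomology_one_of_finite_absoluteGaloisGroup _

omit [NumberField K] [W.IsElliptic] in
/-- `|n| • T = 0` for `T ∈ E[n]`. [folklore] -/
theorem natAbs_nsmul_geomTorsion {n : ℤ} (T : geomTorsion W n) : n.natAbs • T = 0 :=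
  Subtype.ext (natAbs_nsmul_eq_zero.mpr ((mem_geomTorsion_iff W n _).mp T.2))

omit [NumberField K] [W.IsElliptic] in
/-- `2 • T = 0` for `T ∈ E[2]`. [folklore] -/
theorem two_nsmul_geomTorsion_two (T : geomTorsion W 2) : 2 • T = 0 :=
  W.natAbs_nsmul_geomTorsion T

omit [NumberField K] [W.IsElliptic] in
/-- **At an infinite place, `H¹(K_w, E[n]) = 0` for odd `n`** (`Γ_{K_w}` has order `≤ 2` and the group is
killed by `n`). Milne, *ADT*, I Rem. 3.7. [cite: MilneADT2006, I Rem. 3.7] -/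
theorem galoisCohomology_one_torsion_eq_zero_infinitePlace_of_odd (w : InfinitePlace K) {n : ℤ}
    (hn : Odd n) (x : galoisCohomology (GaloisRep.restrictField w.Completion (W.torsionGaloisModule n)) 1) :
    x = 0 :=
  eq_zero_of_odd_nsmul_eq_zero_infinitePlace w _ (Int.natAbs_odd.mpr hn) x
    (nsmul_continuousCohomology_one_eq_zero _ n.natAbs (fun T => W.natAbs_nsmul_geomTorsion T) x)

omit [NumberField K] [W.IsElliptic] in
/-- **At a complex place, `H¹(K_w, E[n]) = 0`** (`Γ_{K_w} = 1`). [folklore] -/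
theorem galoisCohomology_one_torsion_eq_zero_infinitePlace_of_isComplex (w : InfinitePlace K)
    (hw : w.IsComplex) {n : ℤ}
    (x : galoisCohomology (GaloisRep.restrictField w.Completion (W.torsionGaloisModule n)) 1) : x = 0 := by
  haveI : IsAlgClosed w.Completion :=
    isAlgClosed_of_ringEquiv (InfinitePlace.Completion.ringEquivComplexOfIsComplex hw).symm
  haveI := subsingleton_absoluteGaloisGroup_of_isAlgClosed w.Completion
  exact galoisCohomology_one_eq_zero_of_subsingleton _ x

omit [NumberField K] [W.IsElliptic] in
/-- **`H¹(K_w, E)` is killed by every even `n`**: `H¹(K_w, E)[n] = ⊤` for `2 ∣ n` (the group is `2`-torsion,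
tree `two_nsmul_continuousCohomology_one_infinitePlace_eq_zero`). [cite: SerreGaloisCohomology1997, I §2.4] -/
theorem torsionBy_galoisCohomology_localGaloisModule_eq_top_infinitePlace (w : InfinitePlace K) {n : ℤ}
    (hn : 2 ∣ n) : AddSubgroup.torsionBy (galoisCohomology (W.localGaloisModule w.Completion) 1) n = ⊤ := by
  obtain ⟨k, rfl⟩ := hn
  rw [eq_top_iff]
  intro x _
  rw [AddSubgroup.torsionBy, Submodule.mem_toAddSubgroup, Submodule.mem_torsionBy_iff, mul_zsmul, two_zsmul]
  have h := two_nsmul_continuousCohomology_one_infinitePlace_eq_zero w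
    (W.localGaloisModule w.Completion).toTopRep (k • x)
  rwa [two_nsmul] at h

omit [NumberField K] [W.IsElliptic] in
/-- **The real-place input: `#E(K_w)[2] ≤ 2 · [E(K_w) : 2 E(K_w)]` at a real place `w`.**  `E(K_w)[2]`
embeds in `E[2]`, of order `4`; if it has more than `2` elements, two distinct non-zero rational `2`-torsion
points force `2E(K_w) ≠ E(K_w)` (`range_zsmulAddGroupHom_two_ne_top_of_ringEquiv` along `K_w ≃+* ℝ`), so the
(finite, by hypothesis) index is `≥ 2`.  (In Lie-theoretic terms: `E(ℝ) ≅ S¹ × (ℤ/2)^ε` with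
`#E(ℝ)[2] = 2^{1+ε}`, `[E(ℝ) : 2E(ℝ)] = 2^ε`; Milne, *ADT*, I Rem. 3.7.) [cite: MilneADT2006, I Rem. 3.7] -/
theorem natCard_ker_two_le_two_mul_index_of_isReal (w : InfinitePlace K) (hw : w.IsReal)
    (hker : Nat.card (zsmulAddGroupHom 2 : (W.baseChange w.Completion).toAffine.Point →+ _).ker ≤ 4)
    (hidx : (zsmulAddGroupHom 2 : (W.baseChange w.Completion).toAffine.Point →+ _).range.index ≠ 0) :
    Nat.card (zsmulAddGroupHom 2 : (W.baseChange w.Completion).toAffine.Point →+ _).ker ≤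
      2 * (zsmulAddGroupHom 2 : (W.baseChange w.Completion).toAffine.Point →+ _).range.index := by
  by_cases h3 : Nat.card (zsmulAddGroupHom 2 : (W.baseChange w.Completion).toAffine.Point →+ _).ker ≤ 2
  · omega
  · push Not at h3
    haveI : Finite (zsmulAddGroupHom 2 : (W.baseChange w.Completion).toAffine.Point →+ _).ker :=
      Nat.finite_of_card_ne_zero (by omega)
    haveI := Fintype.ofFinite (zsmulAddGroupHom 2 : (W.baseChange w.Completion).toAffine.Point →+ _).ker
    obtain ⟨a, b, c, hab, hac, hbc⟩ :
        ∃ a b c : (zsmulAddGroupHom 2 : (W.baseChange w.Completion).toAffine.Point →+ _).ker,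
          a ≠ b ∧ a ≠ c ∧ b ≠ c := by
      rw [Nat.card_eq_fintype_card] at h3
      exact Fintype.two_lt_card_iff.mp h3
    -- two distinct non-zero `2`-torsion points
    have htwo : ∀ P : (zsmulAddGroupHom 2 : (W.baseChange w.Completion).toAffine.Point →+ _).ker,
        (P : (W.baseChange w.Completion).toAffine.Point) + P = 0 := fun P => by
      have h : (2 : ℤ) • (P : (W.baseChange w.Completion).toAffine.Point) = 0 := P.2
      rwa [two_zsmul] at h
    have key : ∀ P₁ P₂ : (zsmulAddGroupHom 2 : (W.baseChange w.Completion).toAffine.Point →+ _).ker,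
        P₁ ≠ P₂ → (P₁ : (W.baseChange w.Completion).toAffine.Point) ≠ 0 →
        (P₂ : (W.baseChange w.Completion).toAffine.Point) ≠ 0 →
          (zsmulAddGroupHom 2 : (W.baseChange w.Completion).toAffine.Point →+ _).range ≠ ⊤ :=
      fun P₁ P₂ hne h₁ h₂ => W.range_zsmulAddGroupHom_two_ne_top_of_ringEquiv
        (InfinitePlace.Completion.ringEquivRealOfIsReal hw) h₁ h₂ (htwo P₁) (htwo P₂)
        (fun h => hne (Subtype.ext h))
    have hne_top : (zsmulAddGroupHom 2 : (W.baseChange w.Completion).toAffine.Point →+ _).range ≠ ⊤ := by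
      by_cases ha : (a : (W.baseChange w.Completion).toAffine.Point) = 0
      · refine key b c hbc (fun hb => hab (Subtype.ext (ha.trans hb.symm))) fun hc =>
          hac (Subtype.ext (ha.trans hc.symm))
      · by_cases hb : (b : (W.baseChange w.Completion).toAffine.Point) = 0
        · exact key a c hac ha fun hc => hbc (Subtype.ext (hb.trans hc.symm))
        · exact key a b hab ha hb
    have hidx2 : (zsmulAddGroupHom 2 : (W.baseChange w.Completion).toAffine.Point →+ _).range.index ≠ 1 :=
      fun h => hne_top (AddSubgroup.index_eq_one.mp h)
    omega

/-- Arithmetic of the even real case. [folklore] -/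
private theorem le_sq_of_counts {Hn H2 Ln L2 T t : ℕ} (eN : T * Ln = Hn) (e2 : T * L2 = H2)
    (hC : 4 * H2 ≤ t ^ 2) (ht : t ≤ 2 * L2) (hL : L2 ≤ Ln) (hL2 : 0 < L2) : Hn ≤ Ln * Ln := by
  have key : 4 * L2 * Hn ≤ 4 * L2 * (Ln * Ln) :=
    calc 4 * L2 * Hn = 4 * H2 * Ln := by rw [← eN, ← e2]; ring
      _ ≤ t ^ 2 * Ln := Nat.mul_le_mul_right _ hC
      _ ≤ (2 * L2) ^ 2 * Ln := Nat.mul_le_mul_right _ (Nat.pow_le_pow_left ht 2)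
      _ = 4 * L2 * (L2 * Ln) := by ring
      _ ≤ 4 * L2 * (Ln * Ln) := Nat.mul_le_mul_left _ (Nat.mul_le_mul_right _ hL)
  exact Nat.le_of_mul_le_mul_left key (by positivity)

/-- **`#H¹(K_w, E[n]) ≤ (#𝓛_w)²` at every infinite place `w` of `K`, for all `n ≠ 0`** (`𝓛_w` the local
Kummer condition `kummerLocalConditionAt W n K_w`, the image of `E(K_w)/n`): the count which, with the
isotropy of `𝓛_w` and archimedean local duality, makes `𝓛_w` its own annihilator — the archimedean local
input of Milne, *ADT*, I Lemma 6.15 (Tate local duality over `ℝ`, Milne I Thm. 2.13 / Rem. 3.7).  Proof: for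
`n` odd or `w` complex `H¹ = 0`; for `n` even and `w` real,
`4 · #H¹(K_w, E[n]) · #𝓛^{(2)} = 4 · #H¹(K_w, E[2]) · #𝓛^{(n)} ≤ (#E(K_w)[2])² · #𝓛^{(n)} ≤ (2 #𝓛^{(2)})² #𝓛^{(n)} ≤ 4 #𝓛^{(2)} (#𝓛^{(n)})²`
(`torsionBy_… = ⊤`, the local Kummer sequences `natCard_torsionBy_mul_natCard_kummerLocalConditionAt`,
`natCard_continuousCohomology_one_mul_card_le_sq_of_natCard_le_two` for `E[2]`, `#E[2] = 4`,
`H⁰(K_w, E[2]) = E(K_w)[2]`, `natCard_ker_two_le_two_mul_index_of_isReal`, `#𝓛^{(2)} ≤ #𝓛^{(n)}`).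
[cite: MilneADT2006, I Rem. 3.7 and Lemma 6.15] [cite: SilvermanAEC2009, X.§4 diagram (**)] -/
theorem natCard_galoisCohomology_one_torsion_le_sq_infinitePlace (w : InfinitePlace K) {n : ℤ}
    (hn : n ≠ 0) :
    Nat.card (galoisCohomology (GaloisRep.restrictField w.Completion (W.torsionGaloisModule n)) 1) ≤
      Nat.card (W.kummerLocalConditionAt n w.Completion) *
        Nat.card (W.kummerLocalConditionAt n w.Completion) := by
  haveI := finite_absoluteGaloisGroup_completion_infinitePlace w
  have hΓ := natCard_absoluteGaloisGroup_completion_infinitePlace_le_two w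
  haveI : CharZero w.Completion :=
    charZero_of_injective_algebraMap (algebraMap K w.Completion).injective
  have hn2 : (2 : ℤ) ≠ 0 := two_ne_zero
  haveI := W.finite_galoisCohomology_one_torsion_restrictField_of_finite w.Completion hn
  haveI := W.finite_galoisCohomology_one_torsion_restrictField_of_finite w.Completion hn2
  have hLpos : 0 < Nat.card (W.kummerLocalConditionAt n w.Completion) := Nat.card_pos
  -- `H¹ = 0` suffices in the degenerate cases
  have hzero : (∀ x : galoisCohomology (GaloisRep.restrictField w.Completion (W.torsionGaloisModule n)) 1,
      x = 0) → Nat.card (galoisCohomology (GaloisRep.restrictField w.Completion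
        (W.torsionGaloisModule n)) 1) ≤ Nat.card (W.kummerLocalConditionAt n w.Completion) *
          Nat.card (W.kummerLocalConditionAt n w.Completion) := fun h0 => by
    haveI : Subsingleton
        (galoisCohomology (GaloisRep.restrictField w.Completion (W.torsionGaloisModule n)) 1) :=
      ⟨fun a b => (h0 a).trans (h0 b).symm⟩
    rw [Nat.card_of_subsingleton
      (0 : galoisCohomology (GaloisRep.restrictField w.Completion (W.torsionGaloisModule n)) 1)]
    exact Nat.one_le_iff_ne_zero.mpr (Nat.mul_ne_zero hLpos.ne' hLpos.ne')
  rcases Int.even_or_odd n with heven | hodd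
  swap
  · exact hzero fun x => W.galoisCohomology_one_torsion_eq_zero_infinitePlace_of_odd w hodd x
  rcases w.isReal_or_isComplex with hw | hw
  swap
  · exact hzero fun x => W.galoisCohomology_one_torsion_eq_zero_infinitePlace_of_isComplex w hw x
  -- `n` even, `w` real
  have h2n : 2 ∣ n := even_iff_two_dvd.mp heven
  have hL2pos : 0 < Nat.card (W.kummerLocalConditionAt 2 w.Completion) := Nat.card_pos
  -- (i) the local Kummer sequences at levels `n` and `2`; `H¹(K_w, E)[n] = H¹(K_w, E)[2] = ⊤`
  have eN := W.natCard_torsionBy_mul_natCard_kummerLocalConditionAt w.Completion hn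
  have e2 := W.natCard_torsionBy_mul_natCard_kummerLocalConditionAt w.Completion hn2
  rw [W.torsionBy_galoisCohomology_localGaloisModule_eq_top_infinitePlace w h2n] at eN
  rw [W.torsionBy_galoisCohomology_localGaloisModule_eq_top_infinitePlace w (dvd_refl 2)] at e2
  -- (ii) `#𝓛^{(2)} ≤ #𝓛^{(n)}`
  have iN := W.natCard_kummerLocalConditionAt_eq_index w.Completion hn
  have i2 := W.natCard_kummerLocalConditionAt_eq_index w.Completion hn2
  have hrange : (zsmulAddGroupHom n : (W.baseChange w.Completion).toAffine.Point →+ _).range ≤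
      (zsmulAddGroupHom 2 : (W.baseChange w.Completion).toAffine.Point →+ _).range := by
    rintro _ ⟨P, rfl⟩
    obtain ⟨k, hk⟩ := h2n
    exact ⟨k • P, by rw [zsmulAddGroupHom_apply, zsmulAddGroupHom_apply, hk, mul_zsmul]⟩
  have hL2_le : Nat.card (W.kummerLocalConditionAt 2 w.Completion) ≤
      Nat.card (W.kummerLocalConditionAt n w.Completion) := by
    have hdvd := AddSubgroup.index_dvd_of_le hrange
    rw [← iN, ← i2] at hdvd
    exact Nat.le_of_dvd hLpos hdvd
  -- (iii) `4 · #H¹(K_w, E[2]) ≤ (#E(K_w)[2])²` and `#E(K_w)[2] ≤ #E[2] = 4`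
  let X₂ := (GaloisRep.restrictField w.Completion (W.torsionGaloisModule 2)).toTopRep
  haveI : Finite (geomTorsion W 2) := finite_torsionPoints_holds W (AlgebraicClosure K) hn2
  have hC1 := natCard_continuousCohomology_one_mul_card_le_sq_of_natCard_le_two hΓ X₂
    fun T => W.two_nsmul_geomTorsion_two T
  have hM : Nat.card X₂ = 4 := by
    have h := card_torsionPoints_eq_sq_holds W (AlgebraicClosure K) (n := 2) two_ne_zero
    norm_num at h
    exact h
  have hInv : Nat.card {x : X₂ // ∀ g, X₂.ρ g x = x} =
      Nat.card (zsmulAddGroupHom 2 : (W.baseChange w.Completion).toAffine.Point →+ _).ker := by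
    rw [← Nat.card_congr (W.invariantsTorsionEquivKerZSMul w.Completion hn2).toEquiv]
    exact Nat.card_congr (Equiv.subtypeEquivRight fun x => by
      rw [ContinuousRep.mem_invariants]; rfl)
  have hker_le : Nat.card (zsmulAddGroupHom 2 : (W.baseChange w.Completion).toAffine.Point →+ _).ker ≤ 4 := by
    rw [← hInv, ← hM]
    exact Nat.card_le_card_of_injective _ Subtype.val_injective
  have hC1' : 4 * Nat.card (galoisCohomology (GaloisRep.restrictField w.Completion
      (W.torsionGaloisModule 2)) 1) ≤
        Nat.card (zsmulAddGroupHom 2 : (W.baseChange w.Completion).toAffine.Point →+ _).ker ^ 2 := by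
    rw [← hInv, mul_comm]
    exact hM ▸ hC1
  -- (iv) the real input `#E(K_w)[2] ≤ 2 · #𝓛^{(2)}`
  have ht : Nat.card (zsmulAddGroupHom 2 : (W.baseChange w.Completion).toAffine.Point →+ _).ker ≤
      2 * Nat.card (W.kummerLocalConditionAt 2 w.Completion) := by
    rw [i2]
    exact W.natCard_ker_two_le_two_mul_index_of_isReal w hw hker_le (i2 ▸ hL2pos.ne')
  -- (v) arithmetic
  exact le_sq_of_counts eN e2 hC1' ht hL2_le hL2pos

/-- The same count **at the place `Sum.inl w`** of the tree's `Place K`, for the local condition of the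
Kummer Selmer structure `𝓛_w = W.kummerSelmerStructure n (Sum.inl w)` on
`H¹(K_w, E[n]) = H¹((E[n]).toLocal (Sum.inl w))`. [cite: MilneADT2006, I Rem. 3.7 and Lemma 6.15] -/
theorem natCard_galoisCohomology_one_torsion_le_sq_inl (w : InfinitePlace K) {n : ℤ} (hn : n ≠ 0) :
    Nat.card (galoisCohomology ((W.torsionGaloisModule n).toLocal (Sum.inl w)) 1) ≤
      Nat.card (W.kummerSelmerStructure n (Sum.inl w)) * Nat.card (W.kummerSelmerStructure n (Sum.inl w)) :=
  W.natCard_galoisCohomology_one_torsion_le_sq_infinitePlace w hn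

end WeierstrassCurve

/-! ## Maximal isotropy of `𝓛` given the count and the left kernel (any `K`-field; infinite places) -/

namespace Literature.NumberTheory.EllipticCurves

open CategoryTheory _root_.WeierstrassCurve Field Function NumberField
open Literature.NumberTheory.GaloisRepresentations
open Literature.NumberTheory.GaloisRepresentations.DiscreteGaloisModule (mu MuCarrier)
open scoped ContRepresentation

-- Cup products need `LocallyCompactSpace Γ_F`; as in `LocalWeilPairingDuality.lean`, the compactness of
-- absolute Galois groups is a local instance only.
attribute [local instance] absoluteGaloisGroup_compactSpace

section AnyField

variable {K : Type u} [Field K] [CharZero K] (W : WeierstrassCurve K) (n : ℕ) [NeZero n] [W.IsElliptic]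
variable (e : geomTorsion W n → geomTorsion W n → AlgebraicClosure K)
  (hμ : ∀ S T, e S T ^ n = 1)
  (hadd₁ : ∀ S₁ S₂ T, e (S₁ + S₂) T = e S₁ T * e S₂ T)
  (hadd₂ : ∀ S T₁ T₂, e S (T₁ + T₂) = e S T₁ * e S T₂)
variable (F : Type u) [Field F] [Algebra K F] [CharZero F]

attribute [local instance] finite_geomTorsion_of_neZero

/-- **Maximal isotropy of the local Kummer condition from the count and the left kernel**, over ANY
`K`-field `F` of characteristic `0` with `H¹(F, E[n])` finite: if for some additive
`ι : H²(Γ_F, μₙ) → ℤ/n` the pairing `(x, y) ↦ ι(x ∪ₑ y)` on `H¹(F, E[n])` has trivial left kernel (local Tate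
duality at `F` for `E[n]`; at a non-archimedean place this is the tree's `localDuality_bijective`, at a real
place Milne I Thm. 2.13(a)) and `#H¹(F, E[n]) ≤ (#𝓛_F)²`, then for `x ∈ H¹(F, E[n])`,
`(∀ y ∈ 𝓛_F, x ∪ₑ y = 0) ↔ x ∈ 𝓛_F`.  Isotropy (`←`) is the discharged Poonen–Rains fact
(`kummerClass_cupProduct_kummerClass_eq_zero_holds`); maximality is the counting lemma
`forall_mem_apply_eq_zero_iff_of_isotropic_of_card_le`. Milne, *ADT*, I Cor. 3.4 and Lemma 6.15;
Poonen–Rains 2012, Prop. 4.10. [cite: MilneADT2006, Ch. I, Cor. 3.4 and Lemma 6.15] -/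
theorem forall_mem_kummerLocalConditionAt_weilCupProduct_eq_zero_iff_of_leftKernel
    [Finite (galoisCohomology (GaloisRep.restrictField F (W.torsionGaloisModule n)) 1)]
    (hgal : ∀ (σ : absoluteGaloisGroup K) (S T : geomTorsion W n), σ • e S T = e (σ • S) (σ • T))
    (halt : ∀ T, e T T = 1)
    (ι : galoisCohomology (GaloisRep.restrictField F (mu K n)) 2 →+ ZMod n)
    (hdual : ∀ x : galoisCohomology (GaloisRep.restrictField F (W.torsionGaloisModule n)) 1,
      (∀ y, ι (((weilContPairing W n e hμ hadd₁ hadd₂ hgal).restrict (absGaloisRestrict K F)).cupProduct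
        x y) = 0) → x = 0)
    (hcard : Nat.card (galoisCohomology (GaloisRep.restrictField F (W.torsionGaloisModule n)) 1) ≤
      Nat.card (W.kummerLocalConditionAt n F) * Nat.card (W.kummerLocalConditionAt n F))
    (x : galoisCohomology (GaloisRep.restrictField F (W.torsionGaloisModule n)) 1) :
    (∀ y ∈ W.kummerLocalConditionAt n F, ((weilContPairing W n e hμ hadd₁ hadd₂ hgal).restrict
      (absGaloisRestrict K F)).cupProduct x y = 0) ↔ x ∈ W.kummerLocalConditionAt n F := by
  have hnZ : (n : ℤ) ≠ 0 := Int.natCast_ne_zero.mpr (NeZero.ne n)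
  -- isotropy of `𝓛_F` (the discharged Poonen–Rains fact over `F`)
  have hiso : ∀ x ∈ W.kummerLocalConditionAt n F, ∀ y ∈ W.kummerLocalConditionAt n F,
      ((weilContPairing W n e hμ hadd₁ hadd₂ hgal).restrict (absGaloisRestrict K F)).cupProduct x y = 0 :=
    fun x hx y hy => W.cupProduct_eq_zero_of_mem_kummerLocalConditionAt_of_fact n e hnZ
      (kummerClass_cupProduct_kummerClass_eq_zero_holds F) hμ hadd₁ hadd₂ halt hgal hx hy
  refine ⟨fun hx => ?_, fun hx y hy => hiso x hx y hy⟩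
  let P := (weilContPairing W n e hμ hadd₁ hadd₂ hgal).restrict (absGaloisRestrict K F)
  let b : galoisCohomology (GaloisRep.restrictField F (W.torsionGaloisModule n)) 1 →+
      galoisCohomology (GaloisRep.restrictField F (W.torsionGaloisModule n)) 1 →+ ZMod n :=
    AddMonoidHom.mk' (fun x => ι.comp (P.cupProduct x).toAddMonoidHom)
      fun x x' => AddMonoidHom.ext fun y => by
        change ι (P.cupProduct (x + x') y) = ι (P.cupProduct x y) + ι (P.cupProduct x' y)
        exact (congrArg ι (DFunLike.congr_fun (map_add P.cupProduct x x') y)).trans (map_add ι _ _)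
  have hb : ∀ x y, b x y = ι (P.cupProduct x y) := fun _ _ => rfl
  have hbinj : Injective b := by
    refine (injective_iff_map_eq_zero _).mpr fun x hx => hdual x fun y => ?_
    rw [← hb, hx, AddMonoidHom.zero_apply]
  have hH : ∀ y : galoisCohomology (GaloisRep.restrictField F (W.torsionGaloisModule n)) 1, n • y = 0 :=
    nsmul_continuousCohomology_one_eq_zero _ n (fun T : geomTorsion W n => AddSubgroup.torsionBy.nsmul T)
  refine (forall_mem_apply_eq_zero_iff_of_isotropic_of_card_le b hH hbinj (W.kummerLocalConditionAt n F)
    (W.kummerLocalConditionAt n F)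
    (fun x hx y hy => (hb x y).trans ((congrArg ι (hiso x hx y hy)).trans (map_zero ι))) hcard x).mp
    fun y hy => (hb _ y).trans ((congrArg ι (hx y hy)).trans (map_zero ι))

end AnyField

section InfinitePlace

variable {K : Type u} [Field K] [NumberField K] (W : WeierstrassCurve K) (n : ℕ) [NeZero n] [W.IsElliptic]
variable (e : geomTorsion W n → geomTorsion W n → AlgebraicClosure K)
  (hμ : ∀ S T, e S T ^ n = 1)
  (hadd₁ : ∀ S₁ S₂ T, e (S₁ + S₂) T = e S₁ T * e S₂ T)
  (hadd₂ : ∀ S T₁ T₂, e S (T₁ + T₂) = e S T₁ * e S T₂)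
variable (w : InfinitePlace K)

/-- **Maximal isotropy of `𝓛_w` at an infinite place `w`, given archimedean local duality**: if for some
additive `ι : H²(K_w, μₙ) → ℤ/n` the pairing `ι(x ∪ₑ y)` on `H¹(K_w, E[n])` has trivial left kernel (Tate
local duality over `ℝ` for `E[n]`, Milne I Thm. 2.13(a); vacuous at a complex place and for odd `n`, where
`H¹(K_w, E[n]) = 0`), then `(∀ y ∈ 𝓛_w, x ∪ₑ y = 0) ↔ x ∈ 𝓛_w` — the count being
`natCard_galoisCohomology_one_torsion_le_sq_infinitePlace`.  This is the archimedean local input of Milne,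
*ADT*, I Lemma 6.15. [cite: MilneADT2006, I Thm. 2.13, Rem. 3.7 and Lemma 6.15] -/
theorem forall_mem_kummerLocalConditionAt_weilCupProduct_eq_zero_iff_infinitePlace
    (hgal : ∀ (σ : absoluteGaloisGroup K) (S T : geomTorsion W n), σ • e S T = e (σ • S) (σ • T))
    (halt : ∀ T, e T T = 1)
    (ι : galoisCohomology (GaloisRep.restrictField w.Completion (mu K n)) 2 →+ ZMod n)
    (hdual : ∀ x : galoisCohomology (GaloisRep.restrictField w.Completion (W.torsionGaloisModule n)) 1,
      (∀ y, ι (((weilContPairing W n e hμ hadd₁ hadd₂ hgal).restrict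
        (absGaloisRestrict K w.Completion)).cupProduct x y) = 0) → x = 0)
    (x : galoisCohomology (GaloisRep.restrictField w.Completion (W.torsionGaloisModule n)) 1) :
    (∀ y ∈ W.kummerLocalConditionAt n w.Completion, ((weilContPairing W n e hμ hadd₁ hadd₂ hgal).restrict
      (absGaloisRestrict K w.Completion)).cupProduct x y = 0) ↔
      x ∈ W.kummerLocalConditionAt n w.Completion := by
  haveI := finite_absoluteGaloisGroup_completion_infinitePlace w
  haveI : CharZero w.Completion :=
    charZero_of_injective_algebraMap (algebraMap K w.Completion).injective
  have hnZ : (n : ℤ) ≠ 0 := Int.natCast_ne_zero.mpr (NeZero.ne n)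
  haveI := W.finite_galoisCohomology_one_torsion_restrictField_of_finite w.Completion hnZ
  exact forall_mem_kummerLocalConditionAt_weilCupProduct_eq_zero_iff_of_leftKernel W n e hμ hadd₁ hadd₂
    w.Completion hgal halt ι hdual (W.natCard_galoisCohomology_one_torsion_le_sq_infinitePlace w hnZ) x

/-- **Maximal isotropy of the local condition of the Kummer Selmer structure at the infinite place
`Sum.inl w`**, for the local Weil pairing `weilContPairingLocal … (Sum.inl w)` and an additive
`ι : H²(K_w, μₙ) → ℤ/n` (e.g. the component `inv (Sum.inl w)` of a family of local invariant maps) through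
which the local pairing has trivial left kernel: `(∀ y ∈ 𝓛_w, x ∪ₑ y = 0) ↔ x ∈ 𝓛_w`.
[cite: MilneADT2006, I Thm. 2.13, Rem. 3.7 and Lemma 6.15] -/
theorem forall_mem_kummerSelmerStructure_weilCupProduct_eq_zero_iff_inl
    (hgal : ∀ (σ : absoluteGaloisGroup K) (S T : geomTorsion W n), σ • e S T = e (σ • S) (σ • T))
    (halt : ∀ T, e T T = 1)
    (ι : galoisCohomology ((mu K n).toLocal (Sum.inl w)) 2 →+ ZMod n)
    (hdual : ∀ x : galoisCohomology ((W.torsionGaloisModule n).toLocal (Sum.inl w)) 1,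
      (∀ y, ι ((weilContPairingLocal W n e hμ hadd₁ hadd₂ hgal (Sum.inl w)).cupProduct x y) = 0) → x = 0)
    (x : galoisCohomology ((W.torsionGaloisModule n).toLocal (Sum.inl w)) 1) :
    (∀ y ∈ W.kummerSelmerStructure n (Sum.inl w),
        (weilContPairingLocal W n e hμ hadd₁ hadd₂ hgal (Sum.inl w)).cupProduct x y = 0) ↔
      x ∈ W.kummerSelmerStructure n (Sum.inl w) := by
  have h := forall_mem_kummerLocalConditionAt_weilCupProduct_eq_zero_iff_infinitePlace W n e hμ hadd₁ hadd₂
    w hgal halt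
  exact h ι hdual x

end InfinitePlace

end Literature.NumberTheory.EllipticCurves

end
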